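import Summits.RiemannHypothesis.RiemannHypothesis.Theorems.PfPersistenceGroundDecayBit
import HarnessLib

/-!
# CAND SEAT 8 (pub-rhpf-cand-8, gen 8) — ANTITONE EXCLUSION: the zeroth-order form of the C8-N8 / F6 LOCK
and the theorem-sound completion of the sign-blind ordering reader (harness candidate `cand8-016-crossdom-L2-v1`;
helper of stmt-RiemannHypothesis-19953)

mechanism/rigidity campaign; no RH claims.  Everything below is an RH-free, kernel-checked consequence of ONE
input: antitonicity of a windowed ground energy along a nested pair of windows `w ≤ w⁺` (`ε(w⁺) ≤ ε(w)`), which is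
a tree theorem for ζ's continuum form (`weilEvenGroundEnergy_antitone`, `weilOddGroundEnergy_antitoneOn`;
Bombieri 2000 Thm 5) and a hypothesis `hanti` in the model-free §1.  No lower bound on any ground energy is assumed.

* §1 MODEL-FREE LEMMAS over real numbers `e = ε(w)`, `e' = ε(w⁺)` with `e' ≤ e`:
  - `le_neg_of_antitone_flip`, `not_forwardIsomodular` — an object FLIPPED-ISOMODULAR at `w` (`e = -z`, `z` = the
    reference modulus there) has `e' ≤ -z`; if the reference modulus one window deeper is smaller (`z' < z`) the
    object cannot be isomodular at `w⁺` (`|e'| ≠ z'`), and `e'/z' ≤ -(z/z')` (`ratio_le_of_antitone_flip`).  This is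
    the zeroth-order content of cand-8's ROW C8-N8 ('no forward isomodular signed twin', fold) and of fake-6's
    first-order LOCK law `ρ_land = -(1+x)T₀·z/z'` (`PfPersistence.F6.flatTransport_defect_lock`): antitonicity alone
    gives `ρ ≤ -z/z'` with no perturbation model; the first-order law sharpens the constant to `(1+x)T₀ ≈ 2`.
  - `not_ordered_of_dominance` — if `e < 0` and the NEXT level's modulus at `w⁺` is dominated, `o' ≤ |e|`, then the
    modulus ordering `|e'| < o'` at `w⁺` is violated.
  - `pos_of_crossDominance` — contrapositive, the reader's soundness: `|e'| < o'` (ordering at `w⁺`) and `o' ≤ |e|`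
    (cross-window dominance) force `0 < e`.
* §2 ζ-CONTINUUM INSTANCES: `weilEvenGroundEnergy_pos_of_crossDominance` (even sector, barrier = the odd bottom at
  the deeper window), `weilOddGroundEnergy_pos_of_crossDominance` (odd sector, any barrier `x`), and the (Z)-label:
  cross-parity dominance implies the decay bit (`evenDecayBit_of_crossDominance`; no new definitions), hence the eventually-∀a form is
  RH-strength (`riemannHypothesis_of_eventually_crossDominance`, via `riemannHypothesis_of_eventually_evenDecayBit`).
  So the harness reader R = ORD(w) ∧ ORD(w⁺) ∧ DOM_e ∧ DOM_o of `cand8-016` is a Type-B certificate (RULING A13 class),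
  not a candidate invariant; its RH-free content is DATA: ζ satisfies R at every served window with `a ≥ 0.91` and at
  none with `a ≤ 0.9047` (step ≥ 0.045, N = 80…600), and no negative window of the served universe satisfies R
  (0/4272; fixed-N antitonicity holds on 3602/3602 same-series same-N consecutive pairs) — harness verdict of record
  and pub-rhpf-cand-8/CANDIDATES.md §29.
-/

set_option linter.dupNamespace false  -- the mandated namespace repeats `RiemannHypothesis`

open Set
open Literature.NumberTheory.LFunctions

namespace Summit.RiemannHypothesis.RiemannHypothesis.Theorems.PfPersistenceC8AntitoneExclusion

open Summit.RiemannHypothesis.RiemannHypothesis.Theorems.PolarPerronFrobenius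
open Summit.RiemannHypothesis.RiemannHypothesis.Theorems.PfPersistenceGroundDecayBit

/-! ## §1 Model-free lemmas (antitonicity `e' ≤ e` is the only structural input) -/

/-- An object flipped-isomodular at `w` (`e = -z`) is at least as negative one window deeper: `e' ≤ -z`. [folklore] -/
theorem le_neg_of_antitone_flip {e e' z : ℝ} (hanti : e' ≤ e) (hflip : e = -z) : e' ≤ -z :=
  hflip ▸ hanti

/-- **No forward isomodular signed twin (zeroth order).**  If `e' ≤ e = -z` and the deeper reference modulus is
smaller, `z' < z`, then `|e'| ≠ z'`. [folklore] -/
theorem not_forwardIsomodular {e e' z z' : ℝ} (hanti : e' ≤ e) (hflip : e = -z) (hz : z' < z) :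
    |e'| ≠ z' := by
  intro h
  have h1 : e' ≤ -z := le_neg_of_antitone_flip hanti hflip
  have h2 : -e' ≤ |e'| := neg_le_abs e'
  linarith

/-- The transported ratio is locked below `-(z/z')`: `e' ≤ -z` and `0 < z'` give `e' / z' ≤ -(z / z')`. [folklore] -/
theorem ratio_le_of_antitone_flip {e e' z z' : ℝ} (hanti : e' ≤ e) (hflip : e = -z) (hz' : 0 < z') :
    e' / z' ≤ -(z / z') := by
  rw [← neg_div]
  exact div_le_div_of_nonneg_right (le_neg_of_antitone_flip hanti hflip) hz'.le

/-- **Ordering violated under dominance.**  If `e' ≤ e < 0` and `o' ≤ |e|` then `¬ (|e'| < o')`. [folklore] -/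
theorem not_ordered_of_dominance {e e' o' : ℝ} (hanti : e' ≤ e) (hneg : e < 0) (hdom : o' ≤ |e|) :
    ¬ (|e'| < o') := by
  intro hlt
  have hmono : |e| ≤ |e'| := abs_le_abs_of_le_of_nonpos hanti hneg.le
  linarith

/-- **Soundness of the cross-dominance reader (model-free).**  `e' ≤ e`, ordering `|e'| < o'` at the deeper window
and dominance `o' ≤ |e|` force `0 < e`. [folklore] -/
theorem pos_of_crossDominance {e e' o' : ℝ} (hanti : e' ≤ e) (hord : |e'| < o') (hdom : o' ≤ |e|) : 0 < e :=
  pos_of_le_of_abs_lt hanti (lt_of_lt_of_le hord hdom)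

/-! ## §2 ζ-continuum instances and the (Z)-label -/

/-- **Even sector.**  `0 < a ≤ b`, ordering `|ε_ev(b)| < |ε_odd(b)|` at the deeper window and cross-parity dominance
`|ε_odd(b)| ≤ |ε_ev(a)|` give `0 < ε_ev(a)`. [folklore; antitonicity = Bombieri2000Weil §4 Thm 5] -/
theorem weilEvenGroundEnergy_pos_of_crossDominance {a b : ℝ} (ha : 0 < a) (hab : a ≤ b)
    (hord : |weilEvenGroundEnergy b| < |weilOddGroundEnergy b|)
    (hdom : |weilOddGroundEnergy b| ≤ |weilEvenGroundEnergy a|) :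
    0 < weilEvenGroundEnergy a :=
  pos_of_crossDominance (weilEvenGroundEnergy_antitone ha hab) hord hdom

/-- **Odd sector, any barrier.**  `0 < a ≤ b`, `|ε_odd(b)| < x` and `x ≤ |ε_odd(a)|` give `0 < ε_odd(a)` (in the
harness reader `x` is the modulus of the even first-excited level at `b`). [folklore] -/
theorem weilOddGroundEnergy_pos_of_crossDominance {a b x : ℝ} (ha : 0 < a) (hab : a ≤ b)
    (hord : |weilOddGroundEnergy b| < x) (hdom : x ≤ |weilOddGroundEnergy a|) :
    0 < weilOddGroundEnergy a :=
  pos_of_crossDominance (weilOddGroundEnergy_antitoneOn ha (ha.trans_le hab) hab) hord hdom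

/-- Cross-parity dominance at some deeper window (ordering `|ε_ev(b)| < |ε_odd(b)|` at `b` and dominance
`|ε_odd(b)| ≤ |ε_ev(a)|`; the even half of harness reader `cand8-016`) implies the even decay bit at `a`. [folklore] -/
theorem evenDecayBit_of_crossDominance {a : ℝ}
    (h : ∃ b : ℝ, a ≤ b ∧ |weilEvenGroundEnergy b| < |weilOddGroundEnergy b| ∧
      |weilOddGroundEnergy b| ≤ |weilEvenGroundEnergy a|) :
    EvenDecayBit a := by
  obtain ⟨b, hab, hord, hdom⟩ := h
  exact ⟨b, hab, lt_of_lt_of_le hord hdom⟩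

/-- **(Z)-label.**  If every window `a ≥ a₀` (`a > 0`) admits a deeper window with even cross-parity dominance,
the Riemann hypothesis holds (through the decay bit). [folklore] -/
theorem riemannHypothesis_of_eventually_crossDominance {a₀ : ℝ}
    (h : ∀ a : ℝ, a₀ ≤ a → 0 < a → ∃ b : ℝ, a ≤ b ∧ |weilEvenGroundEnergy b| < |weilOddGroundEnergy b| ∧
      |weilOddGroundEnergy b| ≤ |weilEvenGroundEnergy a|) : _root_.RiemannHypothesis :=
  riemannHypothesis_of_eventually_evenDecayBit (a₀ := a₀)
    fun a ha₀ ha ↦ evenDecayBit_of_crossDominance (h a ha₀ ha)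

/-- What the eventual reader gives RH-free: even positivity at every window `a ≥ a₀`. [folklore] -/
theorem weilEvenGroundEnergy_pos_of_eventually_crossDominance {a₀ : ℝ}
    (h : ∀ a : ℝ, a₀ ≤ a → 0 < a → ∃ b : ℝ, a ≤ b ∧ |weilEvenGroundEnergy b| < |weilOddGroundEnergy b| ∧
      |weilOddGroundEnergy b| ≤ |weilEvenGroundEnergy a|) :
    ∀ a : ℝ, a₀ ≤ a → 0 < a → 0 < weilEvenGroundEnergy a := fun a ha₀ ha ↦ by
  obtain ⟨b, hab, hord, hdom⟩ := h a ha₀ ha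
  exact weilEvenGroundEnergy_pos_of_crossDominance ha hab hord hdom

end Summit.RiemannHypothesis.RiemannHypothesis.Theorems.PfPersistenceC8AntitoneExclusion
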